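import Summits.ResolutionOfSingularities.ResolutionOfSingularities.Theses.WeightedInvariant
import Mathlib.RingTheory.AdicCompletion.Algebra
import HarnessLib

/-!
# The `K`-rational chart dictionary of the weighted local game (`LocalWeightedDropRational`, Φ / `chartMonomial` /
# `pointIdeal` / `SuccRing`) — door `HypersurfaceCentreConstruction` (stmt-ResolutionOfSingularities-19897), route `WeightedInvariant`

[OURS · L1 W4.3 · cell `res-hironaka`, HUMAN RULING D-0089] Helper file `--supports stmt-ResolutionOfSingularities-19897`
landed VERBATIM from res-L1-w43-idea-2's statement-level sketch `L/res-L1-w43-idea-2/Sketch-QRat.lean` (sha16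
`bec1a326739df993`; details in its `QRAT-MEMO.md` §1–§7) on res-L1-w43-plan-1's ORDER (o8) 2026-08-27T04:51:57Z
(«the Φ/chart dictionary every port of an engine file to the imperfect-residue game will import»; typer res-type-061,
no new mathematics). AI-produced, weaker than expert review. NOT a statement of the manuscript under review (Hironaka
2017); nothing here is attributed to its author; nothing here is a claim about resolution of singularities. The two
closed game statements `LocalWeightedDropRational` / `LocalWeightedDropRationalPRankOne` are CANDIDATE obligation
nodes (`@[conjecture]`, OURS) for the door's H2a stub — stated, never asserted; the predicates and coordinate defs are
untagged real definitions over Mathlib (`MvPolynomial`, `MvPowerSeries`, `AdicCompletion`).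

Q-rat (i)/(ii) in one paragraph (details: `QRAT-MEMO.md` next to the sketch).
(ii) At a closed point `c` of the chart whose residue field `L = K(c)` is INSEPARABLE over `K`, the successor
germ is NOT "`f` with coefficients mapped to `L`, translated by `c`": the complete local ring `Ô` of the chart at
`c` is a power-series ring over `L` only through a Cohen isomorphism that cannot be chosen `K`-linear (no
coefficient field of `Ô` contains `K`; witness `K = 𝔽_p(t)`, `c = {xᵖ = t} ⊂ 𝔸¹`: if `ξ ∈ Ô` had `ξᵖ = t` then
`(x - ξ)ᵖ = xᵖ - t` would make the uniformizer a `p`-th power). At SEPARABLE points Hensel lifting makes the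
naive base change correct. Hence (i): the rank must be indexed by the RING carrying the germ (equivalently: a
field-indexed rank on `L[[X]]` invariant under ALL ring automorphisms, not only `L`-algebra ones), and (ii): the
successor clause is stated in the `𝔑_c`-adic completion of the chart's polynomial ring, into which `K[[x]]` maps
continuously by `x_i ↦ X₀^{w_i} X_{i+1}` — no base change, no translation, no Cohen choice. The move `θ` and the
weights stay `K`-rational exactly as in the registered `LocalWeightedDrop`.
-/

noncomputable section

set_option linter.dupNamespace false -- mandated namespace `Summit.<Summit>.<Problem>` of this single-conjunct summit

open MvPowerSeries

namespace Summit.ResolutionOfSingularities.ResolutionOfSingularities.Cruxes.HypersurfaceCentreConstruction.LocalEngine.QRat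

/-- [OURS] The chart monomial of coordinate `i` for weights `w`: `X₀^{w i} · X_{i+1}` if `w i > 0` (blown-up
direction), `X_{i+1}` otherwise (direction along the centre). `X₀` is the exceptional parameter `s`. -/
def chartMonomial (K : Type*) [CommRing K] {n : ℕ} (w : Fin n → ℕ) (i : Fin n) :
    MvPolynomial (Fin (n + 1)) K :=
  if 0 < w i then MvPolynomial.X 0 ^ w i * MvPolynomial.X i.succ else MvPolynomial.X i.succ

/-- [OURS] Coordinates of a closed point of the chart LYING OVER THE ORIGIN of the centre: `X₀ = 0` (on the
exceptional divisor), `X_{i+1} = c i` in the blown-up directions, `X_{i+1} = 0` along the centre. The values live in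
a finite extension `L` of `K` (the residue field of the point). -/
def pointCoords {L : Type*} [Zero L] {n : ℕ} (w : Fin n → ℕ) (c : Fin n → L) :
    Fin (n + 1) → L :=
  Fin.cons 0 fun i => if 0 < w i then c i else 0

/-- [OURS] The maximal ideal `𝔑_c ⊂ K[X₀,…,X_n]` of that closed point: the kernel of evaluation at `pointCoords`.
(It is maximal when the evaluation is surjective onto `L`, which the statement below demands.) -/
def pointIdeal (K : Type*) {L : Type*} [Field K] [Field L] [Algebra K L] {n : ℕ} (w : Fin n → ℕ)
    (c : Fin n → L) : Ideal (MvPolynomial (Fin (n + 1)) K) :=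
  RingHom.ker (MvPolynomial.aeval (R := K) (pointCoords w c))

/-- [OURS] The successor ring at the closed point `c`: the `𝔑_c`-adic completion of the chart's polynomial ring —
a complete regular local ring of dimension `n + 1` with residue field `L`; by Cohen it is SOME `L[[u₀,…,u_n]]`, but
not `K`-linearly so when `L/K` is inseparable. -/
abbrev SuccRing (K : Type) {L : Type} [Field K] [Field L] [Algebra K L] {n : ℕ} (w : Fin n → ℕ)
    (c : Fin n → L) : Type :=
  AdicCompletion (pointIdeal K w c) (MvPolynomial (Fin (n + 1)) K)

/-- [OURS] Continuity of the transform map `Φ : K[[x]] → SuccRing` for the adic topologies (so that `Φ` is the unique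
continuous extension of `x_i ↦ chartMonomial i`): series vanishing to high order land in high powers of `𝔑_c`. -/
def IsAdicContinuous {K L : Type} [Field K] [Field L] [Algebra K L] {n : ℕ} (w : Fin n → ℕ) (c : Fin n → L)
    (Φ : MvPowerSeries (Fin n) K →ₐ[K] SuccRing K w c) : Prop :=
  ∀ N : ℕ, ∃ M : ℕ, ∀ q : MvPowerSeries (Fin n) K, (∀ d : Fin n →₀ ℕ, d.degree < M → MvPowerSeries.coeff d q = 0) →
    Φ q ∈ (Ideal.map (algebraMap (MvPolynomial (Fin (n + 1)) K) (SuccRing K w c)) (pointIdeal K w c)) ^ N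

/-- [OURS · L1 w43 idea-2 g3 — H2a typed; CANDIDATE statement for plan-1's door superset skeleton
(`stub_localWeightedDropRational`)] The `K`-RATIONAL weighted game over ARBITRARY fields `K` of characteristic `p`:
a RING-indexed rank `ι` (invariant under ring isomorphisms — Q-rat (i)) such that every singular hypersurface germ
`f ∈ K[[x₁…x_n]]` admits a `K`-rational move (`θ`, `w`) after which, at EVERY CLOSED POINT of the chart over the origin
(coordinates `c` in a finite extension `L = K(c)`, some blown-up coordinate non-zero — Q-rat (ii)), every strict
transform `g` (`Φ(f∘θ) = X₀^a · g`, `X₀ ∤ g`) that is still singular (`g ∈ 𝔑_c²`, the successor ring being regular)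
has smaller rank. Over algebraically closed `K` every closed point is rational, `L = K`, and the clause specialises to
the registered `LocalWeightedDrop` up to the (canonical) identification of `SuccRing` with `K[[X₀,…,X_n]]`. [folklore] -/
@[conjecture]
def LocalWeightedDropRational : Prop :=
  ∀ p : ℕ, p.Prime →
    ∃ ι : (S : Type) → [CommRing S] → S → Ordinal.{0},
      (∀ (S T : Type) [CommRing S] [CommRing T] (e : S ≃+* T) (g : S), ι T (e g) = ι S g) ∧
      ∀ (K : Type) [Field K] [CharP K p] (n : ℕ) (f : MvPowerSeries (Fin n) K),
        (f ≠ 0 ∧ MvPowerSeries.constantCoeff f = 0 ∧ ∀ i, MvPowerSeries.coeff (Finsupp.single i 1) f = 0) →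
        ∃ (θ : Fin n → MvPowerSeries (Fin n) K) (w : Fin n → ℕ),
          (∀ i, MvPowerSeries.constantCoeff (θ i) = 0) ∧
          IsUnit (Matrix.det (Matrix.of fun i j => MvPowerSeries.coeff (Finsupp.single j 1) (θ i))) ∧
          (∃ i, 0 < w i) ∧
          ∀ (L : Type) [Field L] [Algebra K L] [Module.Finite K L] (c : Fin n → L),
            (∃ i, 0 < w i ∧ c i ≠ 0) →
            Function.Surjective (MvPolynomial.aeval (R := K) (pointCoords w c)) →
            ∀ Φ : MvPowerSeries (Fin n) K →ₐ[K] SuccRing K w c,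
              (∀ i, Φ (MvPowerSeries.X i) = algebraMap _ _ (chartMonomial K w i)) →
              IsAdicContinuous w c Φ →
              ∀ (a : ℕ) (g : SuccRing K w c),
                Φ (MvPowerSeries.subst θ f) =
                    algebraMap (MvPolynomial (Fin (n + 1)) K) (SuccRing K w c) (MvPolynomial.X 0) ^ a * g →
                ¬ (algebraMap (MvPolynomial (Fin (n + 1)) K) (SuccRing K w c) (MvPolynomial.X 0) ∣ g) →
                g ∈ (Ideal.map (algebraMap (MvPolynomial (Fin (n + 1)) K) (SuccRing K w c)) (pointIdeal K w c)) ^ 2 →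
                ι (SuccRing K w c) g < ι (MvPowerSeries (Fin n) K) f

/-- [OURS] `p`-rank at most one: `K = Kᵖ(t)` for some `t` (`[K : Kᵖ] ≤ p`). This is exactly what the door's
reductions hand to H2a for SURFACES: `K = κ(ξ)` for `ξ` a generic point of a curve in `Sing X`, `X` a surface over an
algebraically closed `k`, has transcendence degree `1` over `k`, hence `p`-rank `1`; and `p`-rank is inherited by
finite extensions, so the restricted game is closed under successor points. -/
def HasPRankLeOne (p : ℕ) (K : Type*) [Field K] : Prop :=
  ∃ t : K, ∀ x : K, ∃ a : Fin p → K, x = ∑ i, a i ^ p * t ^ (i : ℕ)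

/-- [OURS — the WEAKER superset stub the registrar may prefer] `LocalWeightedDropRational` restricted to fields of
`p`-rank `≤ 1` (all that H1/H1c produce in dimension two). Same clause, one extra hypothesis on `K`; implied by
`LocalWeightedDropRational` by instantiation (`localWeightedDropRationalPRankOne_of`). -/
@[conjecture]
def LocalWeightedDropRationalPRankOne : Prop :=
  ∀ p : ℕ, p.Prime →
    ∃ ι : (S : Type) → [CommRing S] → S → Ordinal.{0},
      (∀ (S T : Type) [CommRing S] [CommRing T] (e : S ≃+* T) (g : S), ι T (e g) = ι S g) ∧
      ∀ (K : Type) [Field K] [CharP K p], HasPRankLeOne p K → ∀ (n : ℕ) (f : MvPowerSeries (Fin n) K),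
        (f ≠ 0 ∧ MvPowerSeries.constantCoeff f = 0 ∧ ∀ i, MvPowerSeries.coeff (Finsupp.single i 1) f = 0) →
        ∃ (θ : Fin n → MvPowerSeries (Fin n) K) (w : Fin n → ℕ),
          (∀ i, MvPowerSeries.constantCoeff (θ i) = 0) ∧
          IsUnit (Matrix.det (Matrix.of fun i j => MvPowerSeries.coeff (Finsupp.single j 1) (θ i))) ∧
          (∃ i, 0 < w i) ∧
          ∀ (L : Type) [Field L] [Algebra K L] [Module.Finite K L] (c : Fin n → L),
            (∃ i, 0 < w i ∧ c i ≠ 0) →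
            Function.Surjective (MvPolynomial.aeval (R := K) (pointCoords w c)) →
            ∀ Φ : MvPowerSeries (Fin n) K →ₐ[K] SuccRing K w c,
              (∀ i, Φ (MvPowerSeries.X i) = algebraMap _ _ (chartMonomial K w i)) →
              IsAdicContinuous w c Φ →
              ∀ (a : ℕ) (g : SuccRing K w c),
                Φ (MvPowerSeries.subst θ f) =
                    algebraMap (MvPolynomial (Fin (n + 1)) K) (SuccRing K w c) (MvPolynomial.X 0) ^ a * g →
                ¬ (algebraMap (MvPolynomial (Fin (n + 1)) K) (SuccRing K w c) (MvPolynomial.X 0) ∣ g) →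
                g ∈ (Ideal.map (algebraMap (MvPolynomial (Fin (n + 1)) K) (SuccRing K w c)) (pointIdeal K w c)) ^ 2 →
                ι (SuccRing K w c) g < ι (MvPowerSeries (Fin n) K) f

/-- [OURS] the restriction is an instantiation. -/
theorem localWeightedDropRationalPRankOne_of (h : LocalWeightedDropRational) :
    LocalWeightedDropRationalPRankOne := by
  intro p hp
  obtain ⟨ι, hι, H⟩ := h p hp
  exact ⟨ι, hι, fun K _ _ _ n f hf => H K n f hf⟩

/-- [OURS] (i) made explicit: a ring-indexed rank restricts to the field-indexed rank plan-1 asked for. The converse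
needs `ιK L m` to be invariant under ALL ring automorphisms of `L[[X]]` (Cohen presentations of `SuccRing` differ by
non-`L`-linear automorphisms when `L` is imperfect), which is why the ring-indexed form is the primitive one. -/
def fieldIndexed (ι : (S : Type) → [CommRing S] → S → Ordinal.{0}) :
    (K : Type) → [Field K] → (n : ℕ) → MvPowerSeries (Fin n) K → Ordinal.{0} :=
  fun K _ n f => ι (MvPowerSeries (Fin n) K) f

/-- [OURS — the NAIVE successor clause, recorded to say where it is WRONG] "base change to `L` and translate":
`f ↦ (map (algebraMap K L) (f∘θ))(X₀^{w}(c + X))`. Correct exactly when `L/K` is separable (Hensel: `K ⊂ Ô` extends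
to a coefficient field `L ⊂ Ô` and `Ô = L[[X - c̃]]`); at inseparable points it computes the germ of the BASE-CHANGED
scheme `X_L` at a rational point, which is not the germ of `X` at `c` (regularity is not even preserved). A door line
typed with this clause would silently replace H2a by the perfect-closure game. -/
def naiveSuccessorGerm {K L : Type} [Field K] [Field L] [Algebra K L] {n : ℕ} (θ : Fin n → MvPowerSeries (Fin n) K)
    (w : Fin n → ℕ) (c : Fin n → L) (f : MvPowerSeries (Fin n) K) : MvPowerSeries (Fin (n + 1)) L :=
  MvPowerSeries.subst
    (fun i : Fin n => if 0 < w i then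
        MvPowerSeries.X (0 : Fin (n + 1)) ^ (w i) * (MvPowerSeries.C (c i) + MvPowerSeries.X i.succ)
      else MvPowerSeries.X i.succ)
    (MvPowerSeries.map (algebraMap K L) (MvPowerSeries.subst θ f))

end Summit.ResolutionOfSingularities.ResolutionOfSingularities.Cruxes.HypersurfaceCentreConstruction.LocalEngine.QRat

end
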